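import Mathlib
import Summits.NavierStokesRegularity.NavierStokesRegularity.Theses.AxisymmetricExtremality
import HarnessLib

/-!
# Route AxisymmetricExtremality — `Assembly` PROVED (stmt-NavierStokesRegularity-15455; pure logic)

`MinimalDatumPFold → PFoldToAxisymmetric → AxisymmetricKatoGlobal → NavierStokesRegularity`: exactly
the route's deciding theorem `closes` (rev 2), by contradiction on the Clay conclusion — a Clay
datum without a Clay solution yields p-fold symmetric minimal blow-up data, hence an axisymmetric
minimal blow-up datum, which `AxisymmetricKatoGlobal` makes global, contradicting minimality.

HONEST FRAMING: pure logic; the route's three cruxes remain OPEN hypotheses (AxisymmetricKatoGlobal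
is a hard core); nothing here bears on the regularity question. Lands
`--workitem stmt-NavierStokesRegularity-15455` (typer seat g19 of cell pub-ns-dss, idle-row item).
-/

namespace Summit.NavierStokesRegularity.NavierStokesRegularity.Theorems

set_option linter.dupNamespace false

/-- **`Assembly` of route AxisymmetricExtremality (stmt-NavierStokesRegularity-15455)**, the curried
deciding theorem (pure logic). [this file] -/
theorem axisymmetricExtremality_assembly_proof : Theses.AxisymmetricExtremality.Assembly := by
  intro h₂ h₄ h₃
  show Literature.NS.NavierStokesExistenceSmoothR3
  intro ν hν u₀ hsm hdiv hdec
  by_contra hno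
  obtain ⟨u₁, g, hmin, hax⟩ := h₄ ν hν (h₂ ν hν ⟨u₀, hsm, hdiv, hdec, hno⟩)
  obtain ⟨hL3, hrep, hdiv₁, -, hnot⟩ := hmin
  exact hnot (h₃ ν hν u₁ g hL3 hrep hdiv₁ hax)

end Summit.NavierStokesRegularity.NavierStokesRegularity.Theorems
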